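import Literature.MathematicalPhysics.QuantumLattice.HeisenbergEnergyDensity
import Literature.MathematicalPhysics.QuantumLattice.LatticeTori
import HarnessLib

/-!
# Cluster product states: exact trial energy and the variational upper bound for the Heisenberg
# model on tori (soundness of the cluster-product / cluster-mean-field upper-bound certificates)

Topic `MathematicalPhysics/QuantumLattice`; continues `HeisenbergTorusSubadditivity.lean` (where the
block product state of TORUS ground states gave the tiling INEQUALITY with a Casimir bound on the
boundary bonds) and `BlockProductStates.lean` (block product states `⨂_b φ`, factorisation of one- and
two-site expectations). Here the blocks are OPEN BOXES and the boundary bonds are evaluated EXACTLY.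

Setting. The spin-`n/2` Heisenberg model `H_L = J Σ_{⟨xy⟩} 𝐒_x·𝐒_y` on the torus `(ℤ/Lℤ)^d`
(`heisenbergHamiltonian n (torusGraph d L) J`, simple nearest-neighbour torus graph, `L ≥ 3`, so that
`H_L = J Σ_x Σ_i 𝐒_x·𝐒_{x+eᵢ}`), box sides `M : Fin d → ℕ` with `k i · M i = L` and `k i ≥ 2` blocks in
every direction, and ONE block state `φ` on the box `Π_i ℤ/(M i)ℤ` (`RectTorusSite M`; positions are
taken mod `M i` only as labels — the box is open). The block decomposition
`HeisenbergTL.boxBlockDecomp : (ℤ/Lℤ)^d ≃ (Π_i ℤ/(k i)ℤ) × (Π_i ℤ/(M i)ℤ)` (block, position) and the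
block product state `Ψ = ⨂_{blocks} φ` (`blockProductState`).

* `HeisenbergTL.clusterTrialEnergy n M φ` — the trial energy PER BLOCK at `J = 1`:
  `Φ(φ) = Σ_f Σ_i [ Re⟨φ, 𝐒_f·𝐒_{f+eᵢ} φ⟩ if f_i + 1 < M i (a bond inside the box);
                     Σ_α Re(⟨φ, Sᵅ_f φ⟩⟨φ, Sᵅ_{f+eᵢ} φ⟩) if f_i + 1 = M i (a bond leaving the box through
                     the face `f_i = M i - 1`; its partner sits at position `f + eᵢ`, i.e. `f_i ↦ 0`, of the
                     NEXT block) ]`.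
* `HeisenbergTL.re_expect_heisenbergHamiltonian_blockProductState` — **the exact identity**
  `Re⟨Ψ, H_L Ψ⟩ = J · (Π_i k i) · Φ(φ)` for `‖φ‖ = 1`, `L ≥ 3`, all `k i ≥ 2`: a bond inside a block has its
  block value (`blockProductState_expect_spinDot_same`), a bond between two DIFFERENT blocks factorises,
  `⟨Ψ, Sᵅ_x Sᵅ_y Ψ⟩ = ⟨φ, Sᵅ_f φ⟩⟨φ, Sᵅ_g φ⟩` (`blockProductState_expect_onSite_onSite_ne`); `k i ≥ 2`
  guarantees that a bond leaving a block through a face enters a different block (for `k i = 1` it would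
  re-enter the same block from the other side).
* `heisenbergTorus_groundEnergy_le_clusterProduct` — **the variational bound**
  `E₀(H_L) ≤ J (Π_i k i) Φ(φ) = J (L^d / Π_i M i) Φ(φ)` (any real `J`, any spin, any `d`).
* Simplifications of the boundary term: for a block state supported in ONE magnetisation sector
  (`Σ_y σ_y` constant on the support) the `Sˣ, Sʸ` expectations vanish
  (`star_dotProduct_siteSpin_mulVec_eq_zero_of_sector`), so only `⟨Sᶻ_f⟩⟨Sᶻ_g⟩` remains
  (`clusterTrialEnergy_eq_of_sector`); for a REAL block state the `Sʸ` expectations vanish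
  (`star_dotProduct_siteSpin_one_mulVec_eq_zero_of_real`, `clusterTrialEnergy_eq_of_real`).
* Thermodynamic limit (`J ≥ 0`, `d ≥ 1`): `heisenbergEnergyDensity n d J ≤ J Φ(φ) / Π_i M i`
  (`heisenbergEnergyDensity_le_clusterProduct`), along the tori `L = (m+3) Π_i M i` and
  `tendsto_heisenbergEnergyDensity`.
* The torus-family forms used by certificate bundles: chain (`d = 1`, segment of `a` sites,
  `a ∣ L`, `2a ≤ L`: `E₀ ≤ q·L` whenever `J Φ ≤ q a`, `heisenbergRing_groundEnergy_le_of_clusterTrialEnergy_le`)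
  and square lattice (`d = 2`, `a × b` box, `a ∣ L`, `b ∣ L`, `2a ≤ L`, `2b ≤ L`, equivalently
  `lcm(a,b) ∣ L`, `2 max(a,b) ≤ L`: `E₀ ≤ q·L²` whenever `J Φ ≤ q a b`,
  `heisenbergSquareTorus_groundEnergy_le_of_clusterTrialEnergy_le{,_lcm}`).

This is the textbook variational principle with a tensor-product trial state whose energy is evaluated
in closed form (Anderson 1951: product/Néel trial states; the "cluster mean-field" improvement keeps a
nonzero boundary magnetisation `⟨Sᶻ_f⟩ ≠ 0` inside a fixed-`Sᶻ` sector of the cluster: Oguchi, Prog.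
Theor. Phys. 13 (1955) 148; Oitmaa–Betts, Can. J. Phys. 56 (1978) 897). Nothing here is specific to a
numerical method: how `φ` was found is irrelevant to the bound. Standard material: H. Tasaki, *Physics and
Mathematics of Quantum Many-Body Systems* (2020) §2.2 (tensor products in the `σ`-basis), §2.5
(variational estimates); P. W. Anderson, Phys. Rev. 83 (1951) 1260. No named facts; the definitions are
bookkeeping (`zmodBlock` carry lemma, `boxBlockDecomp`, `clusterTrialEnergy`).
-/

noncomputable section

open Matrix Complex Finset Filter Topology Literature.Probability.LatticeModels
open scoped ComplexOrder BigOperators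

namespace Literature.MathematicalPhysics.QuantumLattice

namespace HeisenbergTL

/-! ### Crossing a block boundary in `ℤ/kMℤ` -/

section ZModBlocks

variable {k M : ℕ} [NeZero k] [NeZero M]

/-- **Carry**: if the position of `z` is the LAST one of its block (`z mod M = M - 1`), then `z + 1`
lies in the NEXT block (cyclically: the last block is followed by block `0`). [folklore] -/
theorem zmodBlock_add_one_of_eq (z : ZMod (k * M)) (h : (zmodPos k M z).val + 1 = M) :
    zmodBlock k M (z + 1) = zmodBlock k M z + 1 := by
  rw [zmodPos_val] at h
  have hM : 0 < M := Nat.pos_of_ne_zero (NeZero.ne M)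
  set q := z.val / M with hq
  have hzq : z.val + 1 = (q + 1) * M := by
    have h1 : z.val / M * M + z.val % M = z.val := Nat.div_add_mod' z.val M
    rw [← hq] at h1
    rw [add_mul, one_mul]
    omega
  have hz1 : z + 1 = ((z.val + 1 : ℕ) : ZMod (k * M)) := by
    push_cast
    rw [ZMod.natCast_zmod_val]
  have hval : (z + 1).val = (q + 1) % k * M := by
    rw [hz1, ZMod.val_natCast, hzq, Nat.mul_mod_mul_right]
  rw [zmodBlock, zmodBlock, hval, Nat.mul_div_cancel _ hM, ZMod.natCast_mod, ← hq]
  push_cast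
  ring

omit [NeZero k] [NeZero M] in
/-- The position of `z + 1` is the position of `z` plus one (mod `M`). [folklore] -/
theorem zmodPos_add_one (z : ZMod (k * M)) : zmodPos k M (z + 1) = zmodPos k M z + 1 := by
  rw [map_add, map_one]

end ZModBlocks

/-! ### Box blocks: `k i` blocks of side `M i` in direction `i` of the torus `(ℤ/Lℤ)^d` -/

section BoxBlocks

variable {d : ℕ} (L : ℕ) (k M : Fin d → ℕ) [∀ i, NeZero (k i)] [∀ i, NeZero (M i)]
  (hkM : ∀ i, k i * M i = L)

/-- Coordinate `i` of the torus `ℤ/Lℤ` read in `ℤ/(k i · M i)ℤ` (`k i · M i = L`). [folklore] -/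
def boxCast (i : Fin d) : ZMod L ≃+* ZMod (k i * M i) := ZMod.ringEquivCongr (hkM i).symm

/-- **The box-block decomposition of the torus** `(ℤ/Lℤ)^d ≃ (Π_i ℤ/(k i)ℤ) × (Π_i ℤ/(M i)ℤ)` for box
sides `M i` with `k i · M i = L`: a site is (its block, its position inside the block), coordinatewise
`x_i = b_i · M i + f_i`. Tasaki (2020) §2.2 (tensor-product decomposition of a spin system over a
partition of the sites). [folklore] -/
def boxBlockDecomp : TorusSite d L ≃ RectTorusSite k × RectTorusSite M where
  toFun x := (fun i => zmodBlock (k i) (M i) (boxCast L k M hkM i (x i)),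
    fun i => zmodPos (k i) (M i) (boxCast L k M hkM i (x i)))
  invFun p := fun i => (boxCast L k M hkM i).symm (zmodBlockGlue (k i) (M i) (p.1 i) (p.2 i))
  left_inv x := by
    funext i
    simp only
    rw [zmodBlockGlue_block_pos, RingEquiv.symm_apply_apply]
  right_inv p := by
    refine Prod.ext (funext fun i => ?_) (funext fun i => ?_)
    · simp only [RingEquiv.apply_symm_apply]
      exact zmodBlock_glue (p.1 i) (p.2 i)
    · simp only [RingEquiv.apply_symm_apply]
      exact zmodPos_glue (p.1 i) (p.2 i)

variable {L k M}

/-- Block coordinates of a site. [folklore] -/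
theorem boxBlockDecomp_apply_fst (x : TorusSite d L) (i : Fin d) :
    (boxBlockDecomp L k M hkM x).1 i = zmodBlock (k i) (M i) (boxCast L k M hkM i (x i)) := rfl

/-- Positions of a site inside its block. [folklore] -/
theorem boxBlockDecomp_apply_snd (x : TorusSite d L) (i : Fin d) :
    (boxBlockDecomp L k M hkM x).2 i = zmodPos (k i) (M i) (boxCast L k M hkM i (x i)) := rfl

omit [∀ i, NeZero (k i)] [∀ i, NeZero (M i)] in
/-- Coordinate `i` of `x + eᵢ` read in `ℤ/(k i · M i)ℤ` is that of `x` plus one. [folklore] -/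
theorem boxCast_add_single_same (x : TorusSite d L) (i : Fin d) :
    boxCast L k M hkM i ((x + Pi.single i 1 : TorusSite d L) i) = boxCast L k M hkM i (x i) + 1 := by
  rw [Pi.add_apply, Pi.single_eq_same, map_add, map_one]

omit [∀ i, NeZero (k i)] [∀ i, NeZero (M i)] in
/-- Coordinate `j ≠ i` of `x + eᵢ` is that of `x`. [folklore] -/
theorem boxCast_add_single_ne (x : TorusSite d L) {i j : Fin d} (hj : j ≠ i) :
    boxCast L k M hkM j ((x + Pi.single i 1 : TorusSite d L) j) = boxCast L k M hkM j (x j) := by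
  rw [Pi.add_apply, Pi.single_eq_of_ne hj, add_zero]

/-- **The position of `x + eᵢ`** is the position of `x` plus `eᵢ` (mod the box sides) — inside the box
this is the neighbouring position, on the face `f_i = M i - 1` it is the position `f_i ↦ 0` of the partner
site in the next block. [folklore] -/
theorem boxBlockDecomp_snd_add_single (x : TorusSite d L) (i : Fin d) :
    (boxBlockDecomp L k M hkM (x + Pi.single i 1)).2 =
      (boxBlockDecomp L k M hkM x).2 + Pi.single i 1 := by
  funext j
  rw [Pi.add_apply, boxBlockDecomp_apply_snd, boxBlockDecomp_apply_snd]
  by_cases hj : j = i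
  · subst hj
    rw [boxCast_add_single_same, map_add, map_one, Pi.single_eq_same]
  · rw [boxCast_add_single_ne hkM x hj, Pi.single_eq_of_ne hj, add_zero]

/-- **A step inside a block**: if the position of `x` in direction `i` is not the last one, `x + eᵢ`
lies in the same block. [folklore] -/
theorem boxBlockDecomp_fst_add_single_of_lt (x : TorusSite d L) (i : Fin d)
    (h : ((boxBlockDecomp L k M hkM x).2 i).val + 1 < M i) :
    (boxBlockDecomp L k M hkM (x + Pi.single i 1)).1 = (boxBlockDecomp L k M hkM x).1 := by
  funext j
  rw [boxBlockDecomp_apply_fst, boxBlockDecomp_apply_fst]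
  by_cases hj : j = i
  · subst hj
    rw [boxCast_add_single_same]
    exact zmodBlock_add_one_of_lt _ h
  · rw [boxCast_add_single_ne hkM x hj]

/-- **A step across a face**: if the position of `x` in direction `i` IS the last one, `x + eᵢ` lies in
the next block in direction `i`. [folklore] -/
theorem boxBlockDecomp_fst_add_single_of_eq (x : TorusSite d L) (i : Fin d)
    (h : ((boxBlockDecomp L k M hkM x).2 i).val + 1 = M i) :
    (boxBlockDecomp L k M hkM (x + Pi.single i 1)).1 =
      (boxBlockDecomp L k M hkM x).1 + Pi.single i 1 := by
  funext j
  rw [Pi.add_apply, boxBlockDecomp_apply_fst, boxBlockDecomp_apply_fst]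
  by_cases hj : j = i
  · subst hj
    rw [boxCast_add_single_same, Pi.single_eq_same]
    exact zmodBlock_add_one_of_eq _ h
  · rw [boxCast_add_single_ne hkM x hj, Pi.single_eq_of_ne hj, add_zero]

omit [∀ i, NeZero (k i)] [∀ i, NeZero (M i)] in
/-- In `Π_i ℤ/(k i)ℤ` with `k i ≥ 2`, `b ≠ b + eᵢ`: a bond leaving a block through a face enters a
DIFFERENT block. [folklore] -/
theorem rectTorusSite_ne_add_single {i : Fin d} (hk : 2 ≤ k i) (b : RectTorusSite k) :
    b ≠ b + Pi.single i 1 := by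
  intro h
  have h1 := congrFun h i
  rw [Pi.add_apply, Pi.single_eq_same, left_eq_add] at h1
  haveI : Fact (1 < k i) := ⟨by omega⟩
  exact one_ne_zero h1

include hkM in
omit [∀ i, NeZero (k i)] [∀ i, NeZero (M i)] in
/-- The number of blocks times the number of sites per block is the number of sites:
`(Π_i k i)(Π_i M i) = L^d`. [folklore] -/
theorem prod_mul_prod_eq_pow : (∏ i, (k i : ℝ)) * ∏ i, (M i : ℝ) = (L : ℝ) ^ d := by
  have h : ∀ i, (k i : ℝ) * (M i : ℝ) = (L : ℝ) := fun i => by exact_mod_cast hkM i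
  rw [← Finset.prod_mul_distrib]
  simp only [h, Finset.prod_const, Finset.card_univ, Fintype.card_fin]

omit [∀ i, NeZero (M i)] in
/-- The number of blocks is `Π_i k i`. [folklore] -/
theorem card_rectTorusSite_eq_prod : Fintype.card (RectTorusSite k) = ∏ i, k i := by
  rw [Fintype.card_pi]
  exact Finset.prod_congr rfl fun i _ => ZMod.card (k i)

end BoxBlocks

/-! ### Selection rules for single-site expectations -/

section Selection

variable {Λ : Type*} [Fintype Λ] [DecidableEq Λ] {q : ℕ}

/-- **Off-diagonal single-site operators have zero expectation in a state whose support is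
"one-site rigid"**: if `a` has zero diagonal and any two configurations in the support of `φ` that agree
off the site `x` agree at `x` too (e.g. `φ` lies in one magnetisation sector), then `⟨φ, a_x φ⟩ = 0`
(`a_x` moves the support off itself). Tasaki (2020) §2.2, eq. (2.2.5). [folklore] -/
theorem star_dotProduct_onSite_mulVec_eq_zero_of_offDiag (x : Λ) (a : Matrix (Fin q) (Fin q) ℂ)
    (ha : ∀ l, a l l = 0) (φ : TensorIndex Λ q → ℂ)
    (hφ : ∀ σ τ : TensorIndex Λ q, φ σ ≠ 0 → φ τ ≠ 0 → (∀ y, y ≠ x → σ y = τ y) → σ x = τ x) :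
    star φ ⬝ᵥ (onSite x a *ᵥ φ) = 0 := by
  simp only [dotProduct, Pi.star_apply]
  refine Finset.sum_eq_zero fun σ _ => ?_
  rw [LiebMattis.onSite_mulVec_apply, Finset.mul_sum]
  refine Finset.sum_eq_zero fun l _ => ?_
  by_cases hσ : φ σ = 0
  · rw [hσ, star_zero, zero_mul]
  by_cases hl : l = σ x
  · rw [hl, ha, zero_mul, mul_zero]
  by_cases hτ : φ (Function.update σ x l) = 0
  · rw [hτ, mul_zero, mul_zero]
  exfalso
  have h := hφ σ (Function.update σ x l) hσ hτ fun y hy => (Function.update_of_ne hy l σ).symm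
  rw [Function.update_self] at h
  exact hl h.symm

/-- In ONE magnetisation sector the support is one-site rigid: if `Σ_y σ_y = m` on the support of
`φ`, two configurations of the support agreeing off `x` agree at `x`. [folklore] -/
theorem sector_support_rigid {m : ℕ} (φ : TensorIndex Λ q → ℂ)
    (hsec : ∀ σ : TensorIndex Λ q, φ σ ≠ 0 → ∑ y, (σ y : ℕ) = m) (x : Λ) :
    ∀ σ τ : TensorIndex Λ q, φ σ ≠ 0 → φ τ ≠ 0 → (∀ y, y ≠ x → σ y = τ y) → σ x = τ x := by
  intro σ τ hσ hτ hagree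
  have h1 := hsec σ hσ
  have h2 := hsec τ hτ
  rw [← Finset.add_sum_erase _ _ (Finset.mem_univ x)] at h1 h2
  have h3 : ∑ y ∈ Finset.univ.erase x, (σ y : ℕ) = ∑ y ∈ Finset.univ.erase x, (τ y : ℕ) :=
    Finset.sum_congr rfl fun y hy => by rw [hagree y (Finset.ne_of_mem_erase hy)]
  exact Fin.ext (by omega)

/-- Diagonal entries of `S⁺` vanish. [folklore] -/
private theorem spinRaise_apply_diag (n : ℕ) (l : Fin (n + 1)) : spinRaise n l l = 0 := by
  rw [spinRaise_apply, if_neg (by omega)]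

/-- Diagonal entries of `Sˣ` and `Sʸ` vanish. Tasaki (2020) §2.1, eq. (2.1.6). [folklore] -/
theorem spinVec_apply_diag_eq_zero (n : ℕ) {α : Fin 3} (hα : α ≠ 2) (l : Fin (n + 1)) :
    spinVec n α l l = 0 := by
  have hα' : α = 0 ∨ α = 1 := by
    fin_cases α
    · exact Or.inl rfl
    · exact Or.inr rfl
    · exact absurd rfl hα
  rcases hα' with rfl | rfl
  · rw [spinVec_zero, spinX, Matrix.smul_apply, Matrix.add_apply, spinLower_eq_conjTranspose,
      conjTranspose_apply, spinRaise_apply_diag, star_zero, add_zero, smul_zero]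
  · rw [spinVec_one, spinY, Matrix.smul_apply, Matrix.sub_apply, spinLower_eq_conjTranspose,
      conjTranspose_apply, spinRaise_apply_diag, star_zero, sub_zero, smul_zero]

/-- **`⟨Sˣ_x⟩ = ⟨Sʸ_x⟩ = 0` in a state of one magnetisation sector** (`Σ_y σ_y` constant on the
support): `S^±_x` change the sector. Tasaki (2020) §2.2. [folklore] -/
theorem star_dotProduct_siteSpin_mulVec_eq_zero_of_sector (n : ℕ) {m : ℕ}
    (φ : TensorIndex Λ (n + 1) → ℂ) (hsec : ∀ σ : TensorIndex Λ (n + 1), φ σ ≠ 0 → ∑ y, (σ y : ℕ) = m)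
    (x : Λ) {α : Fin 3} (hα : α ≠ 2) :
    star φ ⬝ᵥ (siteSpin n x α *ᵥ φ) = 0 :=
  star_dotProduct_onSite_mulVec_eq_zero_of_offDiag x _ (spinVec_apply_diag_eq_zero n hα) φ
    (sector_support_rigid φ hsec x)

/-- Entries of `S⁺` are real. [folklore] -/
private theorem star_spinRaise_apply (n : ℕ) (l l' : Fin (n + 1)) :
    star (spinRaise n l l') = spinRaise n l l' := by
  rw [spinRaise_apply]
  split_ifs
  · exact Complex.conj_ofReal _
  · exact star_zero _

/-- `Sʸ` is antisymmetric: `(Sʸ)ᵀ = -Sʸ` (its entries are purely imaginary and it is Hermitian).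
Tasaki (2020) §2.1, eq. (2.1.6). [folklore] -/
theorem spinY_transpose (n : ℕ) : (spinY n)ᵀ = -spinY n := by
  ext l l'
  simp only [transpose_apply, Matrix.neg_apply, spinY, Matrix.smul_apply, Matrix.sub_apply,
    spinLower_eq_conjTranspose, conjTranspose_apply, star_spinRaise_apply, smul_eq_mul]
  ring

/-- The transpose of a single-site operator is the single-site operator of the transpose. [folklore] -/
theorem onSite_transpose (x : Λ) (a : Matrix (Fin q) (Fin q) ℂ) : (onSite x a)ᵀ = onSite x aᵀ := by
  ext σ τ
  simp only [onSite, transpose_apply, of_apply]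
  by_cases h : ∀ y, y ≠ x → σ y = τ y
  · rw [if_pos h, if_pos fun y hy => (h y hy).symm]
  · rw [if_neg h, if_neg fun h' => h fun y hy => (h' y hy).symm]

/-- A complex-bilinear quadratic form of an antisymmetric matrix vanishes: `v ⬝ᵥ A v = 0` if
`Aᵀ = -A`. [folklore] -/
theorem dotProduct_mulVec_self_eq_zero_of_transpose_eq_neg {m : Type*} [Fintype m]
    {A : Matrix m m ℂ} (hA : Aᵀ = -A) (v : m → ℂ) : v ⬝ᵥ (A *ᵥ v) = 0 := by
  have h : v ⬝ᵥ (A *ᵥ v) = v ⬝ᵥ (Aᵀ *ᵥ v) := by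
    rw [Matrix.mulVec_transpose, dotProduct_comm v (v ᵥ* A), ← Matrix.dotProduct_mulVec]
  rw [hA, Matrix.neg_mulVec, dotProduct_neg] at h
  have h2 : (2 : ℂ) * (v ⬝ᵥ (A *ᵥ v)) = 0 := by rw [two_mul]; nth_rewrite 2 [h]; ring
  simpa using h2

/-- **`⟨Sʸ_x⟩ = 0` in a REAL state** (`star φ = φ`): `Sʸ_x` is antisymmetric. [folklore] -/
theorem star_dotProduct_siteSpin_one_mulVec_eq_zero_of_real (n : ℕ) (φ : TensorIndex Λ (n + 1) → ℂ)
    (hreal : star φ = φ) (x : Λ) : star φ ⬝ᵥ (siteSpin n x 1 *ᵥ φ) = 0 := by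
  rw [hreal, siteSpin, spinVec_one]
  refine dotProduct_mulVec_self_eq_zero_of_transpose_eq_neg ?_ φ
  rw [onSite_transpose, spinY_transpose]
  ext σ τ
  simp only [onSite, of_apply, Matrix.neg_apply]
  split_ifs <;> simp

/-- The expectation of `Sᵅ_x` is real. [folklore] -/
theorem im_star_dotProduct_siteSpin_mulVec (n : ℕ) (φ : TensorIndex Λ (n + 1) → ℂ) (x : Λ) (α : Fin 3) :
    (star φ ⬝ᵥ (siteSpin n x α *ᵥ φ)).im = 0 := by
  have h := (siteSpin_isHermitian (Λ := Λ) n x α).im_star_dotProduct_mulVec_self φ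
  simpa only [RCLike.im_to_complex] using h

end Selection

/-! ### The trial energy per block and the exact energy of the cluster product state -/

section TrialEnergy

variable {d : ℕ} (n : ℕ) (M : Fin d → ℕ) [∀ i, NeZero (M i)]

/-- **The contribution of the bond `(f, f + eᵢ)` to the trial energy per cluster** (at `J = 1`): the
block value `Re⟨φ, 𝐒_f·𝐒_{f+eᵢ} φ⟩` if the bond stays inside the open box (`f_i + 1 < M i`), and the
mean-field product `Σ_α Re(⟨φ, Sᵅ_f φ⟩⟨φ, Sᵅ_{f+eᵢ} φ⟩)` if it leaves the box through the face
`f_i = M i - 1` (the partner position `f + eᵢ`, `f_i ↦ 0`, is where the partner sits in the NEXT block).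
Anderson (1951); Oguchi (1955). [folklore] -/
def clusterBondTerm (φ : TensorIndex (RectTorusSite M) (n + 1) → ℂ) (f : RectTorusSite M) (i : Fin d) : ℝ :=
  if (f i).val + 1 < M i then (star φ ⬝ᵥ (spinDot n f (f + Pi.single i 1) *ᵥ φ)).re
  else ∑ α : Fin 3, ((star φ ⬝ᵥ (siteSpin n f α *ᵥ φ)) *
    (star φ ⬝ᵥ (siteSpin n (f + Pi.single i 1) α *ᵥ φ))).re

/-- **The trial energy per cluster** of the cluster product state with block state `φ` (at `J = 1`):
the energy of the OPEN box `Π_i {0,…,M i - 1}` in `φ` plus, for every bond leaving the box through a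
face, the mean-field term `Σ_α ⟨Sᵅ_f⟩_φ ⟨Sᵅ_{f+eᵢ}⟩_φ` (`clusterBondTerm`). Positions are labelled by
`Π_i ℤ/(M i)ℤ` only to write the partner position `f + eᵢ` uniformly. Anderson (1951); Oguchi (1955). [folklore] -/
def clusterTrialEnergy (φ : TensorIndex (RectTorusSite M) (n + 1) → ℂ) : ℝ :=
  ∑ f : RectTorusSite M, ∑ i : Fin d, clusterBondTerm n M φ f i

/-- **A bond between two different blocks of a block product state factorises**:
`⟨⨂φ, 𝐒_x·𝐒_y ⨂φ⟩ = Σ_α ⟨φ, Sᵅ_f φ⟩ ⟨φ, Sᵅ_g φ⟩` for `x, y` in different blocks at positions `f, g`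
(`‖φ‖ = 1`). Tasaki (2020) §2.2. [folklore] -/
theorem blockProductState_expect_spinDot_ne {Λ B F : Type*} [Fintype Λ] [DecidableEq Λ]
    [Fintype B] [DecidableEq B] [Fintype F] [DecidableEq F]
    (e : Λ ≃ B × F) (φ : TensorIndex F (n + 1) → ℂ) (hφ : star φ ⬝ᵥ φ = 1)
    {x y : Λ} {b₀ b₁ : B} {f g : F} (hx : e x = (b₀, f)) (hy : e y = (b₁, g)) (hb : b₀ ≠ b₁) :
    star (blockProductState e φ) ⬝ᵥ (spinDot n x y *ᵥ blockProductState e φ) =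
      ∑ α : Fin 3, (star φ ⬝ᵥ (siteSpin n f α *ᵥ φ)) * (star φ ⬝ᵥ (siteSpin n g α *ᵥ φ)) := by
  have hxy : x ≠ y := by
    rintro rfl
    rw [hx] at hy
    exact hb (congrArg Prod.fst hy)
  rw [spinDot_eq_sum_mul_of_ne n hxy, Matrix.sum_mulVec, dotProduct_sum]
  refine Finset.sum_congr rfl fun α _ => ?_
  simp only [siteSpin, ← Matrix.mulVec_mulVec]
  rw [blockProductState_expect_onSite_onSite_ne e φ hx hy hb, hφ, one_pow, mul_one]

variable {n M}
variable {L : ℕ} [NeZero L] {k : Fin d → ℕ} [∀ i, NeZero (k i)] (hkM : ∀ i, k i * M i = L)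

/-- **One bond of the torus in the cluster product state**: its expectation is the block value if the
bond stays in a block and the mean-field product if it crosses a face (`L ≥ 2`, `k i ≥ 2`). [folklore] -/
theorem re_expect_spinDot_blockProductState (hL : 2 ≤ L) (hk : ∀ i, 2 ≤ k i)
    (φ : TensorIndex (RectTorusSite M) (n + 1) → ℂ) (hφ : star φ ⬝ᵥ φ = 1)
    (x : TorusSite d L) (i : Fin d) :
    (star (blockProductState (boxBlockDecomp L k M hkM) φ) ⬝ᵥ
      (spinDot n x (x + Pi.single i 1) *ᵥ blockProductState (boxBlockDecomp L k M hkM) φ)).re =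
      clusterBondTerm n M φ (boxBlockDecomp L k M hkM x).2 i := by
  set e := boxBlockDecomp L k M hkM with he
  have hx : e x = ((e x).1, (e x).2) := rfl
  have hsnd : (e (x + Pi.single i 1)).2 = (e x).2 + Pi.single i 1 :=
    boxBlockDecomp_snd_add_single hkM x i
  unfold clusterBondTerm
  split_ifs with hlt
  · -- a bond inside the block
    have hfst : (e (x + Pi.single i 1)).1 = (e x).1 := boxBlockDecomp_fst_add_single_of_lt hkM x i hlt
    have hy : e (x + Pi.single i 1) = ((e x).1, (e x).2 + Pi.single i 1) := Prod.ext hfst hsnd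
    have hMi : 2 ≤ M i := by omega
    rw [blockProductState_expect_spinDot_same n e φ hφ hx hy (torusSite_ne_add_single hL x i)
      (rectTorusSite_ne_add_single (k := M) hMi _)]
  · -- a bond crossing a face
    have heq : ((e x).2 i).val + 1 = M i := by
      have := ZMod.val_lt ((e x).2 i)
      omega
    have hfst : (e (x + Pi.single i 1)).1 = (e x).1 + Pi.single i 1 :=
      boxBlockDecomp_fst_add_single_of_eq hkM x i heq
    have hy : e (x + Pi.single i 1) = ((e x).1 + Pi.single i 1, (e x).2 + Pi.single i 1) :=
      Prod.ext hfst hsnd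
    rw [blockProductState_expect_spinDot_ne n e φ hφ hx hy (rectTorusSite_ne_add_single (hk i) _),
      Complex.re_sum]

/-- **The exact energy of the cluster product state**: `Re⟨⨂φ, H_L ⨂φ⟩ = J (Π_i k i) Φ(φ)` for the
Heisenberg model on the torus `(ℤ/Lℤ)^d` (`L ≥ 3`) tiled by boxes of sides `M i` (`k i · M i = L`,
`k i ≥ 2`), `‖φ‖ = 1`. Anderson (1951); Tasaki (2020) §2.2, §2.5. [folklore] -/
theorem re_expect_heisenbergHamiltonian_blockProductState (n : ℕ) (J : ℝ) (hL : 3 ≤ L)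
    (hk : ∀ i, 2 ≤ k i) (φ : TensorIndex (RectTorusSite M) (n + 1) → ℂ) (hφ : star φ ⬝ᵥ φ = 1) :
    (star (blockProductState (boxBlockDecomp L k M hkM) φ) ⬝ᵥ
      (heisenbergHamiltonian n (torusGraph d L) J *ᵥ blockProductState (boxBlockDecomp L k M hkM) φ)).re =
      J * (∏ i, (k i : ℝ)) * clusterTrialEnergy n M φ := by
  set e := boxBlockDecomp L k M hkM with he
  rw [re_expect_heisenbergHamiltonian_torus n hL J]
  set t : RectTorusSite M → Fin d → ℝ := fun f i => clusterBondTerm n M φ f i with ht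
  have hbond : ∀ (x : TorusSite d L) (i : Fin d),
      (star (blockProductState e φ) ⬝ᵥ
        (spinDot n x (x + Pi.single i 1) *ᵥ blockProductState e φ)).re = t (e x).2 i := by
    intro x i
    rw [he, re_expect_spinDot_blockProductState hkM (by omega) hk φ hφ x i]
  have hsum : ∑ x : TorusSite d L, ∑ i : Fin d,
      (star (blockProductState e φ) ⬝ᵥ
        (spinDot n x (x + Pi.single i 1) *ᵥ blockProductState e φ)).re =
      (∏ i, (k i : ℝ)) * clusterTrialEnergy n M φ := by
    calc ∑ x : TorusSite d L, ∑ i : Fin d,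
        (star (blockProductState e φ) ⬝ᵥ
          (spinDot n x (x + Pi.single i 1) *ᵥ blockProductState e φ)).re
        = ∑ x : TorusSite d L, ∑ i : Fin d, t (e x).2 i :=
          Finset.sum_congr rfl fun x _ => Finset.sum_congr rfl fun i _ => hbond x i
      _ = ∑ p : RectTorusSite k × RectTorusSite M, ∑ i : Fin d, t p.2 i :=
          e.sum_comp (fun p => ∑ i : Fin d, t p.2 i)
      _ = ∑ _b : RectTorusSite k, ∑ f : RectTorusSite M, ∑ i : Fin d, t f i :=
          Fintype.sum_prod_type _
      _ = (∏ i, (k i : ℝ)) * clusterTrialEnergy n M φ := by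
          rw [Finset.sum_const, Finset.card_univ, card_rectTorusSite_eq_prod, nsmul_eq_mul]
          push_cast
          rfl
  rw [hsum]
  ring

end TrialEnergy

end HeisenbergTL

/-! ### The variational bound -/

section Main

variable {d : ℕ} {L : ℕ} [NeZero L] {k M : Fin d → ℕ} [∀ i, NeZero (k i)] [∀ i, NeZero (M i)]

open HeisenbergTL

/-- **Cluster-product variational upper bound for the Heisenberg model on a torus** (any spin `n/2`,
any real `J`, any `d`): if the torus `(ℤ/Lℤ)^d`, `L ≥ 3`, is tiled by `Π_i k i` boxes of sides `M i`
(`k i · M i = L`, `k i ≥ 2`), then for every unit block state `φ`,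
`E₀(H_L) ≤ J (Π_i k i) Φ(φ)` with the trial energy per cluster `Φ = clusterTrialEnergy n M φ`
(open-box energy + mean-field boundary terms). The trial state is `⨂_{blocks} φ`. Anderson (1951);
Tasaki (2020) §2.5. [folklore] -/
theorem heisenbergTorus_groundEnergy_le_clusterProduct (n : ℕ) (J : ℝ) (hL : 3 ≤ L)
    (hkM : ∀ i, k i * M i = L) (hk : ∀ i, 2 ≤ k i)
    (φ : TensorIndex (RectTorusSite M) (n + 1) → ℂ) (hφ : star φ ⬝ᵥ φ = 1) :
    (heisenbergHamiltonian n (torusGraph d L) J).groundEnergy ≤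
      J * (∏ i, (k i : ℝ)) * clusterTrialEnergy n M φ := by
  haveI : Nonempty (TensorIndex (TorusSite d L) (n + 1)) := ⟨fun _ => 0⟩
  have hH := heisenbergHamiltonian_isHermitian (Λ := TorusSite d L) n (torusGraph d L) J
  have hΨ1 : star (blockProductState (boxBlockDecomp L k M hkM) φ) ⬝ᵥ
      blockProductState (boxBlockDecomp L k M hkM) φ = 1 := by
    rw [star_blockProductState_dotProduct_self, hφ, one_pow]
  have hvar := Matrix.groundEnergy_le_rayleigh_holds hH _ hΨ1
  rwa [re_expect_heisenbergHamiltonian_blockProductState hkM n J hL hk φ hφ] at hvar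

/-- The same bound with the number of blocks written as `L^d / Π_i M i`. [folklore] -/
theorem heisenbergTorus_groundEnergy_le_clusterProduct' (n : ℕ) (J : ℝ) (hL : 3 ≤ L)
    (hkM : ∀ i, k i * M i = L) (hk : ∀ i, 2 ≤ k i)
    (φ : TensorIndex (RectTorusSite M) (n + 1) → ℂ) (hφ : star φ ⬝ᵥ φ = 1) :
    (heisenbergHamiltonian n (torusGraph d L) J).groundEnergy ≤
      J * ((L : ℝ) ^ d / ∏ i, (M i : ℝ)) * clusterTrialEnergy n M φ := by
  have h := heisenbergTorus_groundEnergy_le_clusterProduct n J hL hkM hk φ hφ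
  have hM : (∏ i, (M i : ℝ)) ≠ 0 :=
    Finset.prod_ne_zero_iff.2 fun i _ => Nat.cast_ne_zero.2 (NeZero.ne (M i))
  have hprod : (∏ i, (k i : ℝ)) = (L : ℝ) ^ d / ∏ i, (M i : ℝ) := by
    rw [eq_div_iff hM, prod_mul_prod_eq_pow hkM]
  rwa [hprod] at h

end Main

/-! ### The boundary term for sector states and for real states -/

section Simplified

variable {d : ℕ} (n : ℕ) (M : Fin d → ℕ) [∀ i, NeZero (M i)]

open HeisenbergTL

/-- **Sector block states**: if the block state lies in ONE magnetisation sector (`Σ_y σ_y = m` on its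
support — e.g. a vector given in an `Sᶻ`-sector basis of the cluster), the mean-field boundary term is
`⟨Sᶻ_f⟩⟨Sᶻ_{f+eᵢ}⟩` only (the `Sˣ, Sʸ` expectations vanish). This is the functional of the
"cluster-mean-field" certificates. Oguchi (1955); Tasaki (2020) §2.2. [folklore] -/
theorem HeisenbergTL.clusterBondTerm_eq_of_sector {m : ℕ} (φ : TensorIndex (RectTorusSite M) (n + 1) → ℂ)
    (hsec : ∀ σ : TensorIndex (RectTorusSite M) (n + 1), φ σ ≠ 0 → ∑ y, (σ y : ℕ) = m)
    (f : RectTorusSite M) (i : Fin d) :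
    clusterBondTerm n M φ f i =
      if (f i).val + 1 < M i then (star φ ⬝ᵥ (spinDot n f (f + Pi.single i 1) *ᵥ φ)).re
      else (star φ ⬝ᵥ (siteSpin n f 2 *ᵥ φ)).re * (star φ ⬝ᵥ (siteSpin n (f + Pi.single i 1) 2 *ᵥ φ)).re := by
  unfold clusterBondTerm
  split_ifs with h
  · rfl
  · rw [Fin.sum_univ_three,
      star_dotProduct_siteSpin_mulVec_eq_zero_of_sector n φ hsec f (show (0 : Fin 3) ≠ 2 by decide),
      star_dotProduct_siteSpin_mulVec_eq_zero_of_sector n φ hsec f (show (1 : Fin 3) ≠ 2 by decide),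
      zero_mul, zero_mul, Complex.zero_re, zero_add, zero_add, Complex.mul_re,
      im_star_dotProduct_siteSpin_mulVec, zero_mul, sub_zero]

/-- **Real block states**: if the block state is real (`star φ = φ`), the mean-field boundary term is
`⟨Sˣ_f⟩⟨Sˣ_{f+eᵢ}⟩ + ⟨Sᶻ_f⟩⟨Sᶻ_{f+eᵢ}⟩` (the `Sʸ` expectations vanish). This is the functional of
the real matrix-product-state cluster certificates. Tasaki (2020) §2.2. [folklore] -/
theorem HeisenbergTL.clusterBondTerm_eq_of_real (φ : TensorIndex (RectTorusSite M) (n + 1) → ℂ)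
    (hreal : star φ = φ) (f : RectTorusSite M) (i : Fin d) :
    clusterBondTerm n M φ f i =
      if (f i).val + 1 < M i then (star φ ⬝ᵥ (spinDot n f (f + Pi.single i 1) *ᵥ φ)).re
      else (star φ ⬝ᵥ (siteSpin n f 0 *ᵥ φ)).re * (star φ ⬝ᵥ (siteSpin n (f + Pi.single i 1) 0 *ᵥ φ)).re +
        (star φ ⬝ᵥ (siteSpin n f 2 *ᵥ φ)).re * (star φ ⬝ᵥ (siteSpin n (f + Pi.single i 1) 2 *ᵥ φ)).re := by
  unfold clusterBondTerm
  split_ifs with h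
  · rfl
  · rw [Fin.sum_univ_three, star_dotProduct_siteSpin_one_mulVec_eq_zero_of_real n φ hreal f, zero_mul,
      Complex.zero_re, add_zero]
    simp only [Complex.mul_re, im_star_dotProduct_siteSpin_mulVec, mul_zero, sub_zero]

end Simplified

/-! ### Thermodynamic limit -/

section ThermodynamicLimit

variable {d : ℕ}

open HeisenbergTL

/-- **Cluster-product upper bound on the ground-state energy density** (`J ≥ 0`, `d ≥ 1`, any spin):
for every box `Π_i {0,…,M i - 1}` and every unit block state `φ`,
`e(n, d, J) ≤ J Φ(φ) / Π_i M i` (`Φ = clusterTrialEnergy n M φ`): apply the torus bound along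
`L = (m + 3) Π_i M i` and pass to the limit (`tendsto_heisenbergEnergyDensity`). Anderson (1951);
Ruelle (1969) §2.2. [folklore] -/
theorem heisenbergEnergyDensity_le_clusterProduct (n : ℕ) (hd : 1 ≤ d) {J : ℝ} (hJ : 0 ≤ J)
    (M : Fin d → ℕ) [∀ i, NeZero (M i)]
    (φ : TensorIndex (RectTorusSite M) (n + 1) → ℂ) (hφ : star φ ⬝ᵥ φ = 1) :
    heisenbergEnergyDensity n d J ≤ J * clusterTrialEnergy n M φ / ∏ i, (M i : ℝ) := by
  have hMpos : ∀ i, 0 < M i := fun i => Nat.pos_of_ne_zero (NeZero.ne (M i))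
  set P : ℕ := ∏ i, M i with hP
  have hPpos : 0 < P := Finset.prod_pos fun i _ => hMpos i
  have hdvd : ∀ i, M i ∣ P := fun i => Finset.dvd_prod_of_mem M (Finset.mem_univ i)
  set Ls : ℕ → ℕ := fun m => P * (m + 3) with hLs
  have hLs_tendsto : Tendsto Ls atTop atTop := by
    refine tendsto_atTop_mono (fun m => ?_) tendsto_id
    show m ≤ P * (m + 3)
    nlinarith
  have hlim := (tendsto_heisenbergEnergyDensity n hd hJ).comp hLs_tendsto
  refine le_of_tendsto' hlim fun m => ?_
  haveI : NeZero (Ls m) := ⟨Nat.pos_iff_ne_zero.1 (Nat.mul_pos hPpos (by omega))⟩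
  have hL3 : 3 ≤ Ls m := by
    show 3 ≤ P * (m + 3)
    nlinarith
  set k : Fin d → ℕ := fun i => P / M i * (m + 3) with hk
  have hkq : ∀ i, 1 ≤ P / M i := fun i => Nat.div_pos (Nat.le_of_dvd hPpos (hdvd i)) (hMpos i)
  haveI : ∀ i, NeZero (k i) := fun i => ⟨Nat.pos_iff_ne_zero.1 (Nat.mul_pos (hkq i) (by omega))⟩
  have hkM : ∀ i, k i * M i = Ls m := by
    intro i
    show P / M i * (m + 3) * M i = P * (m + 3)
    rw [mul_right_comm, Nat.div_mul_cancel (hdvd i)]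
  have hk2 : ∀ i, 2 ≤ k i := by
    intro i
    show 2 ≤ P / M i * (m + 3)
    nlinarith [hkq i]
  have h := heisenbergTorus_groundEnergy_le_clusterProduct' n J hL3 hkM hk2 φ hφ
  have hLpos : (0 : ℝ) < ((Ls m : ℕ) : ℝ) ^ d := by positivity
  have hPR : (0 : ℝ) < ∏ i, (M i : ℝ) := Finset.prod_pos fun i _ => Nat.cast_pos.2 (hMpos i)
  rw [Function.comp_apply, heisenbergTorusEnergy_eq, div_le_iff₀ hLpos]
  calc (heisenbergHamiltonian n (torusGraph d (Ls m)) J).groundEnergy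
      ≤ J * (((Ls m : ℕ) : ℝ) ^ d / ∏ i, (M i : ℝ)) * clusterTrialEnergy n M φ := h
    _ = J * clusterTrialEnergy n M φ / (∏ i, (M i : ℝ)) * ((Ls m : ℕ) : ℝ) ^ d := by
        field_simp

end ThermodynamicLimit

/-! ### Torus-family forms (chain and square lattice) -/

section Families

open HeisenbergTL

/-- The entries of `![a, b, …]` inherit `NeZero` (so that `Π_i ℤ/(![a,b] i)ℤ` is a finite type by
instance search). [folklore] -/
instance HeisenbergTL.neZero_vecCons_apply {m : ℕ} (a : ℕ) (v : Fin m → ℕ) [NeZero a]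
    [∀ i, NeZero (v i)] (i : Fin (m + 1)) : NeZero (Matrix.vecCons a v i) := by
  refine Fin.cases ?_ (fun j => ?_) i
  · simpa using (inferInstance : NeZero a)
  · simpa using (inferInstance : NeZero (v j))

/-- The (vacuous) base case of `HeisenbergTL.neZero_vecCons_apply`. [folklore] -/
instance HeisenbergTL.neZero_vecEmpty_apply (i : Fin 0) : NeZero ((Matrix.vecEmpty : Fin 0 → ℕ) i) :=
  i.elim0

/-- **Chain form** (`d = 1`): a unit state `φ` of the open segment of `a ≥ 2` sites with
`J Φ(φ) ≤ q a` certifies `E₀(H_L) ≤ q L` on every ring `ℤ/Lℤ` with `a ∣ L`, `2a ≤ L`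
(`H_L = J Σ_i 𝐒_i·𝐒_{i+1}`, spin `n/2`). Here `Φ = clusterTrialEnergy n (fun _ => a) φ` is the segment
energy `Σ_{j<a-1} Re⟨φ, 𝐒_j·𝐒_{j+1} φ⟩` plus the single boundary term `Σ_α Re(⟨Sᵅ_{a-1}⟩⟨Sᵅ_0⟩)`. This is
the shape of the ring-family upper-bound rows `∀ L, a ∣ L → 2a ≤ L → E₀ ≤ q·L` of certificate bundles.
Anderson (1951). [folklore] -/
theorem heisenbergRing_groundEnergy_le_of_clusterTrialEnergy_le (n : ℕ) (J : ℝ) {a : ℕ} [NeZero a]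
    (ha : 2 ≤ a) (φ : TensorIndex (TorusSite 1 a) (n + 1) → ℂ) (hφ : star φ ⬝ᵥ φ = 1) {q : ℝ}
    (hq : J * clusterTrialEnergy n (fun _ : Fin 1 => a) φ ≤ q * a)
    (L : ℕ) [NeZero L] (hdvd : a ∣ L) (hL : 2 * a ≤ L) :
    (heisenbergHamiltonian n (torusGraph 1 L) J).groundEnergy ≤ q * L := by
  obtain ⟨c, hc⟩ := hdvd
  have hc2 : 2 ≤ c := by
    have h1 : a * 2 ≤ a * c := by rw [← hc]; omega
    exact Nat.le_of_mul_le_mul_left h1 (by omega)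
  haveI : NeZero c := ⟨by omega⟩
  have hkM : ∀ i : Fin 1, (fun _ : Fin 1 => c) i * (fun _ : Fin 1 => a) i = L := fun _ => by
    show c * a = L
    rw [hc, mul_comm]
  have h := heisenbergTorus_groundEnergy_le_clusterProduct (k := fun _ => c) (M := fun _ => a) n J
    (by omega) hkM (fun _ => hc2) φ hφ
  rw [Fin.prod_univ_one] at h
  have hcR : (0 : ℝ) ≤ (c : ℝ) := Nat.cast_nonneg c
  have hLR : (L : ℝ) = (a : ℝ) * c := by exact_mod_cast hc
  calc (heisenbergHamiltonian n (torusGraph 1 L) J).groundEnergy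
      ≤ J * (c : ℝ) * clusterTrialEnergy n (fun _ : Fin 1 => a) φ := h
    _ = (c : ℝ) * (J * clusterTrialEnergy n (fun _ : Fin 1 => a) φ) := by ring
    _ ≤ (c : ℝ) * (q * a) := mul_le_mul_of_nonneg_left hq hcR
    _ = q * L := by rw [hLR]; ring

/-- **Square-lattice form** (`d = 2`): a unit state `φ` of the open `a × b` box with `J Φ(φ) ≤ q a b`
certifies `E₀(H_L) ≤ q L²` on every torus `(ℤ/Lℤ)²` with `a ∣ L`, `b ∣ L`, `2a ≤ L`, `2b ≤ L`
(`H_L = J Σ_{⟨xy⟩} 𝐒_x·𝐒_y`, spin `n/2`; `Φ = clusterTrialEnergy n ![a, b] φ` = box energy + the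
mean-field terms of the `b` bonds leaving through the right column and the `a` bonds leaving through the
top row). Anderson (1951); Oguchi (1955). [folklore] -/
theorem heisenbergSquareTorus_groundEnergy_le_of_clusterTrialEnergy_le (n : ℕ) (J : ℝ) {a b : ℕ}
    [∀ i, NeZero (![a, b] i)] (ha : 2 ≤ a) (φ : TensorIndex (RectTorusSite ![a, b]) (n + 1) → ℂ)
    (hφ : star φ ⬝ᵥ φ = 1) {q : ℝ} (hq : J * clusterTrialEnergy n ![a, b] φ ≤ q * a * b)
    (L : ℕ) [NeZero L] (hdvda : a ∣ L) (hdvdb : b ∣ L) (hLa : 2 * a ≤ L) (hLb : 2 * b ≤ L) :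
    (heisenbergHamiltonian n (torusGraph 2 L) J).groundEnergy ≤ q * (L : ℝ) ^ 2 := by
  have hb0 : b ≠ 0 := by simpa using (NeZero.ne (![a, b] 1))
  obtain ⟨c, hc⟩ := hdvda
  obtain ⟨c', hc'⟩ := hdvdb
  have hc2 : 2 ≤ c := by
    have h1 : a * 2 ≤ a * c := by rw [← hc]; omega
    exact Nat.le_of_mul_le_mul_left h1 (by omega)
  have hc'2 : 2 ≤ c' := by
    have h1 : b * 2 ≤ b * c' := by rw [← hc']; omega
    exact Nat.le_of_mul_le_mul_left h1 (Nat.pos_of_ne_zero hb0)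
  haveI : ∀ i, NeZero (![c, c'] i) := by
    haveI : NeZero c := ⟨by omega⟩
    haveI : NeZero c' := ⟨by omega⟩
    infer_instance
  have hkM : ∀ i : Fin 2, ![c, c'] i * ![a, b] i = L := by
    intro i
    fin_cases i
    · show c * a = L
      rw [hc, mul_comm]
    · show c' * b = L
      rw [hc', mul_comm]
  have hk2 : ∀ i : Fin 2, 2 ≤ ![c, c'] i := by
    intro i
    fin_cases i
    · exact hc2
    · exact hc'2
  have h := heisenbergTorus_groundEnergy_le_clusterProduct' n J (by omega) hkM hk2 φ hφ
  rw [Fin.prod_univ_two] at h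
  have hab : (0 : ℝ) < (a : ℝ) * b := by
    have : 0 < a * b := Nat.mul_pos (by omega) (Nat.pos_of_ne_zero hb0)
    exact_mod_cast this
  calc (heisenbergHamiltonian n (torusGraph 2 L) J).groundEnergy
      ≤ J * ((L : ℝ) ^ 2 / ((![a, b] 0 : ℕ) * (![a, b] 1 : ℕ) : ℝ)) * clusterTrialEnergy n ![a, b] φ := h
    _ = (L : ℝ) ^ 2 / ((a : ℝ) * b) * (J * clusterTrialEnergy n ![a, b] φ) := by
        simp only [Matrix.cons_val_zero, Matrix.cons_val_one]
        ring
    _ ≤ (L : ℝ) ^ 2 / ((a : ℝ) * b) * (q * a * b) :=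
        mul_le_mul_of_nonneg_left hq (by positivity)
    _ = q * (L : ℝ) ^ 2 := by
        field_simp

/-- The same square-lattice form with the hypotheses on `L` written as `lcm(a, b) ∣ L` and
`2 max(a, b) ≤ L`. [folklore] -/
theorem heisenbergSquareTorus_groundEnergy_le_of_clusterTrialEnergy_le_lcm (n : ℕ) (J : ℝ) {a b : ℕ}
    [∀ i, NeZero (![a, b] i)] (ha : 2 ≤ a) (φ : TensorIndex (RectTorusSite ![a, b]) (n + 1) → ℂ)
    (hφ : star φ ⬝ᵥ φ = 1) {q : ℝ} (hq : J * clusterTrialEnergy n ![a, b] φ ≤ q * a * b)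
    (L : ℕ) [NeZero L] (hdvd : Nat.lcm a b ∣ L) (hL : 2 * max a b ≤ L) :
    (heisenbergHamiltonian n (torusGraph 2 L) J).groundEnergy ≤ q * (L : ℝ) ^ 2 :=
  heisenbergSquareTorus_groundEnergy_le_of_clusterTrialEnergy_le n J ha φ hφ hq L
    ((Nat.dvd_lcm_left a b).trans hdvd) ((Nat.dvd_lcm_right a b).trans hdvd)
    (le_trans (Nat.mul_le_mul_left 2 (le_max_left a b)) hL)
    (le_trans (Nat.mul_le_mul_left 2 (le_max_right a b)) hL)

end Families


end Literature.MathematicalPhysics.QuantumLattice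

end
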